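import Summits.RiemannHypothesis.RiemannHypothesis.Theses.WeilWindowFlow
import Summits.RiemannHypothesis.RiemannHypothesis.Theorems.GronwallLeakage.Negative.Structure
import Summits.RiemannHypothesis.RiemannHypothesis.Theorems.GronwallLeakage.Negative.LoadBearing
import Summits.RiemannHypothesis.RiemannHypothesis.Theorems.WeilWindowFlowGronwallLeakageStrictAnti
import Literature.NumberTheory.LFunctions.WeilDilationVirialDeriv
import HarnessLib

/-!
# Hadamard's variation inequality for the window bottom, in window variables
(crux stmt-RiemannHypothesis-1037 `GronwallLeakage`, route WeilWindowFlow; line `Sketch`, lead c7) — unconditional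

The route treats the window `a` as TIME and asks for a leakage law
`ε(a) ≥ ε(b) exp(-∫_b^a C)` for the bottom `ε = weilGroundEnergy`. Its mechanism (i) is Hadamard's
domain variation along Bombieri's dilation `g_η(t) = (1+η)^{1/2} g((1+η) t)` (Bombieri 2000, §4,
proof of Thm 5), whose first variation is the DILATION VIRIAL `weilDilationVirial g = Re W(D(g ⋆ g̃))`
(`Literature/…/WeilDilationVirial.lean`; the variation theorem
`hasDerivAt_re_weilQuadratic_weilDilate` and its integrated form are
`Literature/…/WeilDilationVirialDeriv.lean`).

This file states the resulting EXACT, regularity-free inequality for `ε` at the level of test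
functions, in the window ("time") variable. For a unit test function `g` of the window `[-a, a]`
let `g^{(w)} := g_{a/w - 1}` be its dilate living at window `w > 0` (`g^{(a)} = g`), and
`𝒱_g(w) := weilDilationVirial (g^{(w)})` the virial along the orbit. Then for ALL windows `b > 0`

  `ε(b) ≤ Re Q(g) + ∫_b^a 𝒱_g(w) dw / w`        (`weilGroundEnergy_le_add_integral_orbitVirial`):

compressing `g` from window `a` to a smaller window `b` costs at most the integral of
(virial / window) along the way, and expanding it to `b > a` GAINS at least `∫_a^b 𝒱_g(w) dw/w`.
With a bound `𝒱_g ≤ M` on `[b, a]` this is the logarithmic-clock estimate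
`ε(b) - Re Q(g) ≤ M log(a/b)` (`weilGroundEnergy_sub_le_mul_log`), and with `m ≤ 𝒱_g` on `[a, b]`
the drop estimate `ε(b) - Re Q(g) ≤ -m log(b/a)` (`weilGroundEnergy_sub_le_neg_mul_log`).
Taking `g` a near-minimiser at `a` (`Re Q(g) ≤ ε(a) + τ`) these are the two one-sided Hadamard
inequalities for `ε` itself, with the virial of the near-minimiser's orbit as the rate and `log a`
as the natural clock. (What the crux adds, and what is RH-strength, is a bound on that rate in terms
of the ENERGY `ε(a)` uniformly over near-minimisers — items DiniLeakage/DerivLeakage.)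

Axioms ⊆ {propext, Classical.choice, Quot.sound}.
-/

-- `Summit.RiemannHypothesis.RiemannHypothesis.…` repeats a namespace component by design (D-0017 layout).
set_option linter.dupNamespace false

noncomputable section

open MeasureTheory Set Filter
open scoped Topology

namespace Summit.RiemannHypothesis.RiemannHypothesis.Theorems.WeilWindowFlowGronwallLeakage

open Literature.NumberTheory.LFunctions
open Summit.RiemannHypothesis.Cruxes.GronwallLeakage.Negative

/-! ## Change of variables: dilation parameter `η` ↔ window `w = a/(1+η)` -/

/-- The integrated virial in the dilation parameter equals the orbit integral in the window variable:
for `0 < a`, `0 < b` and `η = a/b - 1`,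
`∫₀^η weilDilationVirial (g_s)/(1+s) ds = ∫_b^a weilDilationVirial (g_{a/w-1}) dw/w`
(substitute `s = a/w - 1`). [folklore] -/
theorem integral_weilDilationVirial_orbit_eq {g : ℝ → ℂ} (hg : IsWeilTest g) {a b : ℝ}
    (ha : 0 < a) (hb : 0 < b) :
    ∫ s in (0 : ℝ)..(a / b - 1), weilDilationVirial (weilDilate s g) / (1 + s) =
      ∫ w in b..a, weilDilationVirial (weilDilate (a / w - 1) g) / w := by
  -- the substitution `f(w) = a/w - 1`, `f'(w) = -a/w²`, from `w = a` (`s = 0`) to `w = b` (`s = η`)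
  set G : ℝ → ℝ := fun s ↦ weilDilationVirial (weilDilate s g) / (1 + s) with hG
  set f : ℝ → ℝ := fun w ↦ a / w - 1 with hf
  set f' : ℝ → ℝ := fun w ↦ -a / w ^ 2 with hf'
  have hpos : ∀ w ∈ uIcc a b, 0 < w := by
    intro w hw
    rcases le_total a b with h | h
    · rw [uIcc_of_le h] at hw; exact ha.trans_le hw.1
    · rw [uIcc_of_ge h] at hw; exact hb.trans_le hw.1
  have hderiv : ∀ w ∈ uIcc a b, HasDerivAt f (f' w) w := by
    intro w hw
    have hw0 : w ≠ 0 := (hpos w hw).ne'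
    have h1 : HasDerivAt (fun w : ℝ ↦ a / w) (-a / w ^ 2) w := by
      have h := (hasDerivAt_inv hw0).const_mul a
      have e1 : (fun y : ℝ ↦ a * y⁻¹) = fun y ↦ a / y := by
        funext y; rw [div_eq_mul_inv]
      have e2 : a * -(w ^ 2)⁻¹ = -a / w ^ 2 := by rw [div_eq_mul_inv]; ring
      rw [e1, e2] at h
      exact h
    simpa [hf, hf'] using h1.sub_const 1
  have hcont' : ContinuousOn f' (uIcc a b) := by
    refine ContinuousOn.div continuousOn_const (by fun_prop) fun w hw ↦ ?_
    exact pow_ne_zero 2 (hpos w hw).ne'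
  have himage : f '' uIcc a b ⊆ Ioi (-1) := by
    rintro _ ⟨w, hw, rfl⟩
    have hw0 : 0 < w := hpos w hw
    simp only [hf, mem_Ioi]
    have : 0 < a / w := div_pos ha hw0
    linarith
  have hGcont : ContinuousOn G (f '' uIcc a b) := by
    refine ContinuousOn.mono ?_ himage
    refine ContinuousOn.div (continuousOn_weilDilationVirial_weilDilate hg) (by fun_prop) ?_
    intro s hs
    simp only [mem_Ioi] at hs
    linarith
  have key := intervalIntegral.integral_comp_mul_deriv' hderiv hcont' hGcont
  -- `key : ∫ w in a..b, (G ∘ f) w * f' w = ∫ s in f a..f b, G s`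
  have hfa : f a = 0 := by simp [hf, div_self ha.ne']
  have hfb : f b = a / b - 1 := rfl
  rw [hfa, hfb] at key
  rw [← key, intervalIntegral.integral_symm b a, ← intervalIntegral.integral_neg]
  refine intervalIntegral.integral_congr fun w hw ↦ ?_
  have hw0 : 0 < w := hpos w (by rwa [uIcc_comm])
  simp only [Function.comp_apply, hG, hf, hf']
  have h1 : 1 + (a / w - 1) = a / w := by ring
  rw [h1]
  field_simp

/-! ## The leakage inequality along dilation orbits -/

/-- **Hadamard's variation inequality for the window bottom, window variables.** For a unit test
function `g` of the window `[-a, a]` (`a > 0`) and every window `b > 0`: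
`ε(b) ≤ Re Q(g) + ∫_b^a weilDilationVirial (g_{a/w - 1}) dw/w`,
where `g_{a/w-1} = weilDilate (a/w - 1) g` is the dilate of `g` living at window `w`
(`tsupport ⊆ [-w, w]`, unit norm). For `b < a` (compression) the integral runs forward and bounds the
rise of the bottom to the left; for `b > a` (expansion) it is `-∫_a^b` and bounds the bottom at the
larger window from above by `Re Q(g)` MINUS the accumulated virial. Proof: the dilate `g_{a/b-1}` is
a unit competitor at window `b` (Bombieri 2000, proof of Thm 5), its form value is `Re Q(g)` plus the
integrated virial (`weilGroundEnergy_div_le_add_integral_weilDilationVirial`), and the substitution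
`s = a/w - 1`. [cite: Bombieri2000Weil, §4 proof of Thm 5 (competitor); the inequality: folklore] -/
theorem weilGroundEnergy_le_add_integral_orbitVirial :
    ∀ (g : ℝ → ℂ) (a b : ℝ), IsWeilTest g → 0 < a → 0 < b → tsupport g ⊆ Icc (-a) a →
      ∫ t : ℝ, ‖g t‖ ^ 2 = 1 →
      weilGroundEnergy b ≤ (weilQuadratic g).re +
        ∫ w in b..a, weilDilationVirial (weilDilate (a / w - 1) g) / w := by
  intro g a b hg ha hb hsupp hnorm
  have hη : -1 < a / b - 1 := by
    have : 0 < a / b := div_pos ha hb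
    linarith
  have h := weilGroundEnergy_div_le_add_integral_weilDilationVirial hg hsupp hnorm hη
  have hw : a / (1 + (a / b - 1)) = b := by
    rw [show (1 : ℝ) + (a / b - 1) = a / b by ring]
    field_simp [ha.ne', hb.ne']
  rwa [hw, integral_weilDilationVirial_orbit_eq hg ha hb] at h

/-- **Logarithmic-clock estimate (compression).** If the orbit virial is `≤ M` on `[b, a]`
(`0 < b ≤ a`), then `ε(b) - Re Q(g) ≤ M log(a/b)` for every unit test function `g` of the window
`[-a, a]`: the natural clock of the window flow at the level of one test function is `log a`.
[folklore] -/
theorem weilGroundEnergy_sub_le_mul_log {g : ℝ → ℂ} (hg : IsWeilTest g) {a b M : ℝ}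
    (hb : 0 < b) (hba : b ≤ a) (hsupp : tsupport g ⊆ Icc (-a) a)
    (hnorm : ∫ t : ℝ, ‖g t‖ ^ 2 = 1)
    (hM : ∀ w ∈ Icc b a, weilDilationVirial (weilDilate (a / w - 1) g) ≤ M) :
    weilGroundEnergy b - (weilQuadratic g).re ≤ M * Real.log (a / b) := by
  have ha : 0 < a := hb.trans_le hba
  have h := weilGroundEnergy_le_add_integral_orbitVirial g a b hg ha hb hsupp hnorm
  have hcont : ContinuousOn (fun w : ℝ ↦ weilDilationVirial (weilDilate (a / w - 1) g) / w)
      (Icc b a) := by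
    have hφ : ContinuousOn (fun w : ℝ ↦ a / w - 1) (Icc b a) := by
      refine (ContinuousOn.div continuousOn_const (by fun_prop) fun w hw ↦ ?_).sub continuousOn_const
      exact (hb.trans_le hw.1).ne'
    have hmaps : MapsTo (fun w : ℝ ↦ a / w - 1) (Icc b a) (Ioi (-1)) := by
      intro w hw
      have : 0 < a / w := div_pos ha (hb.trans_le hw.1)
      simp only [mem_Ioi]
      linarith
    refine ContinuousOn.div ((continuousOn_weilDilationVirial_weilDilate hg).comp hφ hmaps)
      (by fun_prop) fun w hw ↦ (hb.trans_le hw.1).ne'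
  have hint : IntervalIntegrable (fun w : ℝ ↦ weilDilationVirial (weilDilate (a / w - 1) g) / w)
      volume b a := (hcont.mono (by rw [uIcc_of_le hba])).intervalIntegrable
  have hint' : IntervalIntegrable (fun w : ℝ ↦ M * w⁻¹) volume b a := by
    refine (ContinuousOn.intervalIntegrable ?_)
    rw [uIcc_of_le hba]
    exact ContinuousOn.mul continuousOn_const
      (continuousOn_inv₀.mono fun w hw ↦ (hb.trans_le hw.1).ne')
  have hmono : ∫ w in b..a, weilDilationVirial (weilDilate (a / w - 1) g) / w ≤
      ∫ w in b..a, M * w⁻¹ := by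
    refine intervalIntegral.integral_mono_on hba hint hint' fun w hw ↦ ?_
    have hw0 : 0 < w := hb.trans_le hw.1
    rw [div_eq_mul_inv]
    exact mul_le_mul_of_nonneg_right (hM w hw) (inv_nonneg.2 hw0.le)
  have hlog : ∫ w in b..a, M * w⁻¹ = M * Real.log (a / b) := by
    rw [intervalIntegral.integral_const_mul, integral_inv_of_pos hb ha]
  linarith

/-- **Logarithmic-clock estimate (expansion).** If the orbit virial is `≥ m` on `[a, b]`
(`0 < a ≤ b`), then `ε(b) - Re Q(g) ≤ -m log(b/a)` for every unit test function `g` of the window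
`[-a, a]`: expanding a test function with positive virial LOWERS the bottom at a logarithmic rate.
[folklore] -/
theorem weilGroundEnergy_sub_le_neg_mul_log {g : ℝ → ℂ} (hg : IsWeilTest g) {a b m : ℝ}
    (ha : 0 < a) (hab : a ≤ b) (hsupp : tsupport g ⊆ Icc (-a) a)
    (hnorm : ∫ t : ℝ, ‖g t‖ ^ 2 = 1)
    (hm : ∀ w ∈ Icc a b, m ≤ weilDilationVirial (weilDilate (a / w - 1) g)) :
    weilGroundEnergy b - (weilQuadratic g).re ≤ -(m * Real.log (b / a)) := by
  have hb : 0 < b := ha.trans_le hab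
  have h := weilGroundEnergy_le_add_integral_orbitVirial g a b hg ha hb hsupp hnorm
  rw [intervalIntegral.integral_symm] at h
  have hcont : ContinuousOn (fun w : ℝ ↦ weilDilationVirial (weilDilate (a / w - 1) g) / w)
      (Icc a b) := by
    have hφ : ContinuousOn (fun w : ℝ ↦ a / w - 1) (Icc a b) := by
      refine (ContinuousOn.div continuousOn_const (by fun_prop) fun w hw ↦ ?_).sub continuousOn_const
      exact (ha.trans_le hw.1).ne'
    have hmaps : MapsTo (fun w : ℝ ↦ a / w - 1) (Icc a b) (Ioi (-1)) := by
      intro w hw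
      have : 0 < a / w := div_pos ha (ha.trans_le hw.1)
      simp only [mem_Ioi]
      linarith
    refine ContinuousOn.div ((continuousOn_weilDilationVirial_weilDilate hg).comp hφ hmaps)
      (by fun_prop) fun w hw ↦ (ha.trans_le hw.1).ne'
  have hint : IntervalIntegrable (fun w : ℝ ↦ weilDilationVirial (weilDilate (a / w - 1) g) / w)
      volume a b := (hcont.mono (by rw [uIcc_of_le hab])).intervalIntegrable
  have hint' : IntervalIntegrable (fun w : ℝ ↦ m * w⁻¹) volume a b := by
    refine (ContinuousOn.intervalIntegrable ?_)
    rw [uIcc_of_le hab]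
    exact ContinuousOn.mul continuousOn_const
      (continuousOn_inv₀.mono fun w hw ↦ (ha.trans_le hw.1).ne')
  have hmono : ∫ w in a..b, m * w⁻¹ ≤
      ∫ w in a..b, weilDilationVirial (weilDilate (a / w - 1) g) / w := by
    refine intervalIntegral.integral_mono_on hab hint' hint fun w hw ↦ ?_
    have hw0 : 0 < w := ha.trans_le hw.1
    rw [div_eq_mul_inv]
    exact mul_le_mul_of_nonneg_right (hm w hw) (inv_nonneg.2 hw0.le)
  have hlog : ∫ w in a..b, m * w⁻¹ = m * Real.log (b / a) := by
    rw [intervalIntegral.integral_const_mul, integral_inv_of_pos ha hb]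
  linarith

/-! ## Good near-minimisers pay virial under compression (uses strict antitonicity, lead c6) -/

/-- **Compressing a good near-minimiser costs virial.** If `0 < a`, `0 < b` and a unit test function
`g` of the window `[-a, a]` has `Re Q(g) < ε(b)` — for `b < a`, a near-minimiser at `a` with slack
below the STRICT gap `ε(b) - ε(a) > 0` of `weilGroundEnergy_lt_of_lt` — then its accumulated orbit
virial on `[b, a]` is positive: `0 < ∫_b^a 𝒱_g(w) dw/w`. [folklore] -/
theorem integral_orbitVirial_pos_of_re_weilQuadratic_lt {g : ℝ → ℂ} (hg : IsWeilTest g) {a b : ℝ}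
    (ha : 0 < a) (hb : 0 < b) (hsupp : tsupport g ⊆ Icc (-a) a)
    (hnorm : ∫ t : ℝ, ‖g t‖ ^ 2 = 1) (hlt : (weilQuadratic g).re < weilGroundEnergy b) :
    0 < ∫ w in b..a, weilDilationVirial (weilDilate (a / w - 1) g) / w := by
  have h := weilGroundEnergy_le_add_integral_orbitVirial g a b hg ha hb hsupp hnorm
  linarith

/-- Such near-minimisers exist for every `0 < b < a`: `ε(a) < ε(b)` STRICTLY
(`weilGroundEnergy_lt_of_lt`, lead c6's `WeilWindowFlowGronwallLeakageStrictAnti.lean`) and `ε(a)` is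
the infimum of `Re Q` over the unit test functions of the window. [folklore] -/
theorem exists_unit_test_re_weilQuadratic_lt {a b : ℝ} (hb : 0 < b) (hba : b < a) :
    ∃ g : ℝ → ℂ, IsWeilTest g ∧ tsupport g ⊆ Icc (-a) a ∧ ∫ t : ℝ, ‖g t‖ ^ 2 = 1 ∧
      (weilQuadratic g).re < weilGroundEnergy b := by
  have ha : 0 < a := hb.trans hba
  have hlt : weilGroundEnergy a < weilGroundEnergy b := weilGroundEnergy_lt_of_lt hb hba
  unfold weilGroundEnergy at hlt
  obtain ⟨x, ⟨g, hg, hsupp, hnorm, rfl⟩, hx⟩ := exists_lt_of_csInf_lt (sphereValues_nonempty ha) hlt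
  exact ⟨g, hg, hsupp, hnorm, hx⟩

/-- **Hence: for `0 < b < a` some unit test function of the window `[-a, a]` has positive accumulated
orbit virial on `[b, a]`** — the variation-calculus shadow of the strict decrease of the bottom.
[folklore] -/
theorem exists_unit_test_integral_orbitVirial_pos {a b : ℝ} (hb : 0 < b) (hba : b < a) :
    ∃ g : ℝ → ℂ, IsWeilTest g ∧ tsupport g ⊆ Icc (-a) a ∧ ∫ t : ℝ, ‖g t‖ ^ 2 = 1 ∧
      0 < ∫ w in b..a, weilDilationVirial (weilDilate (a / w - 1) g) / w := by
  obtain ⟨g, hg, hsupp, hnorm, hlt⟩ := exists_unit_test_re_weilQuadratic_lt hb hba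
  exact ⟨g, hg, hsupp, hnorm,
    integral_orbitVirial_pos_of_re_weilQuadratic_lt hg (hb.trans hba) hb hsupp hnorm hlt⟩

/-! ## Where the two one-sided inequalities meet: differentiability points (a.e.) -/

/-- **`ε` is differentiable at almost every window `a > 0`** (it is antitone on `(0, ∞)` —
`weilGroundEnergy_antitone_of_pos'`, Bombieri 2000 Thm 5 — and monotone functions are differentiable
Lebesgue-a.e.). At such a window the compression and expansion inequalities above bound the same
number `ε'(a)` from the two sides; the quantifier `DifferentiableAt ℝ weilGroundEnergy a` of item
`DerivLeakage` (stmt-RiemannHypothesis-14754) is therefore satisfied at a.e. window. [folklore] -/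
theorem ae_differentiableAt_weilGroundEnergy :
    ∀ᵐ a : ℝ, 0 < a → DifferentiableAt ℝ weilGroundEnergy a := by
  have hmono : MonotoneOn (fun a : ℝ ↦ -weilGroundEnergy a) (Ioi 0) := fun b hb a _ hba ↦
    neg_le_neg (weilGroundEnergy_antitone_of_pos' hb hba)
  filter_upwards [hmono.ae_differentiableWithinAt_of_mem] with a ha hpos
  have h1 : DifferentiableWithinAt ℝ (fun a : ℝ ↦ -weilGroundEnergy a) (Ioi 0) a := ha hpos
  have h2 : DifferentiableAt ℝ (fun a : ℝ ↦ -weilGroundEnergy a) a :=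
    h1.differentiableAt (Ioi_mem_nhds hpos)
  simpa using h2.neg

end Summit.RiemannHypothesis.RiemannHypothesis.Theorems.WeilWindowFlowGronwallLeakage

end
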